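import Summits.QuantumAdvantage.QuantumAdvantage.Theses.RingFrame
import Summits.QuantumAdvantage.AdviceFreeQNC0.EliminationHardness
import HarnessLib

/-!
# Route RingFrame, aside `RingHardLogDeg` (stmt-QuantumAdvantage-19453): the aside is BELOW the
# rung leaf — `RingHard 2 → RingHardLogDeg`, hence `RingToElim → RingHardLogDeg`

The aside `RingHardLogDeg` (degree `log₄ n − log₄(log₂ n + 1) − 3`, one absolute `θ < 1`) is the
`c = 1` instance of the rung leaf `RingHard 2` (degree `(log₂ n)^c`, one `θ` for every `c`) up to
`Smolensky.lowDeg_mono`: `log₄ n − log₄(log₂ n + 1) − 3 ≤ log₄ n ≤ log₂ n` (`Nat.log_anti_left`).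
The route's tribunal recorded this monotonicity check in a seat folder (`bc/scase.lean`, never in the
tree); here it is in the kernel, together with its composition with the crux:

* `ringHardLogDeg_of_ringHard_two : RingHard 2 → RingHardLogDeg`;
* `ringHardLogDeg_of_ringToElim : RingToElim → RingHardLogDeg` (the crux's antecedent `ElimHard` is
  the tree theorem `elimHard`, `EliminationHardness.lean`).

So the moment α (`RingToElim`, stmt-QuantumAdvantage-19119) is proved — the cell's tube-bound line
(ROUND-11: `TubeMass → BinomTailLower → WalkHardAll → RingToElim`, kernel-checked modulo `Reflection`
and `BinomTailLower` at the time of writing) — the aside closes by the one-liner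
`ringHardLogDeg_of_ringToElim ringToElim_proof`.  The cell's bookkeeping (prover qn-prover-3 gen 7,
2026-08-27).  WHAT THIS IS NOT: conditional; credits nothing by itself; separation NOT moved.
-/

-- the sub-problem namespace `Summit.QuantumAdvantage.QuantumAdvantage` repeats the summit name by design (D-0017)
set_option linter.dupNamespace false

noncomputable section

namespace Summit.QuantumAdvantage.QuantumAdvantage.Theorems

open Finset Summit.QuantumAdvantage.AdviceFreeQNC0
open Summit.QuantumAdvantage.QuantumAdvantage.Theses.RingFrame
open Literature.Computability.QuantumComplexity Literature.Computability.QuantumComplexity.RingHLF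
open Literature.Computability.MetaComplexity Literature.Computability.MetaComplexity.Smolensky

/-- The aside's degree is at most `log₂ n = (log₂ n)^1`. -/
theorem asideDeg_le_log (n : ℕ) :
    Nat.log 4 n - Nat.log 4 (Nat.log 2 n + 1) - 3 ≤ (Nat.log 2 n) ^ 1 := by
  rw [pow_one]
  exact le_trans (Nat.sub_le _ _) (le_trans (Nat.sub_le _ _) (Nat.log_anti_left (by norm_num) (by norm_num)))

/-- **`RingHard 2 → RingHardLogDeg`**: the aside is the `c = 1` instance of the rung leaf, by
monotonicity of `lowDeg` in the degree. -/
theorem ringHardLogDeg_of_ringHard_two (h : Summit.QuantumAdvantage.AdviceFreeQNC0.RingHard 2) :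
    RingHardLogDeg := by
  classical
  obtain ⟨θ, hθ, hc⟩ := h
  obtain ⟨n₀, hn₀⟩ := hc 1
  refine ⟨θ, hθ, n₀, fun n hn P hP => ?_⟩
  have hP' : ∀ i, P i ∈ lowDeg (ZMod 2) n ((Nat.log 2 n) ^ 1) :=
    fun i => lowDeg_mono (asideDeg_le_log n) (hP i)
  have h := hn₀ n hn P hP'
  convert h using 4

/-- **`RingToElim → RingHardLogDeg`**: the crux α implies the aside (the crux's antecedent is the
tree theorem `elimHard`). -/
theorem ringHardLogDeg_of_ringToElim (h : RingToElim) : RingHardLogDeg := by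
  unfold RingToElim at h
  exact ringHardLogDeg_of_ringHard_two (h elimHard)

end Summit.QuantumAdvantage.QuantumAdvantage.Theorems

end
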